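import Mathlib
import Literature.AlgebraicGeometry.Resolution.RegularLocalRingsQuotient
import Literature.AlgebraicGeometry.Resolution.RegularLocalRingsJacobian

/-!
# TropicalLinks / SchonResolves — regularity along a Cartier divisor and on its complement

Route `ResolutionOfSingularities/TropicalLinks`, crux `SchonResolves` (stmt-ResolutionOfSingularities-17234),
seed line `zariski-toric-closure`. Two generic pieces of commutative algebra by which the regularity of
a partial compactification `X̄ ⊇ U` with boundary divisor `D = {x = 0}` is reduced to the regularity of
`U = X̄ ∖ D` and of `D` (used chart by chart on tropical compactifications of schön very affine
varieties, file `TropicalLinksSchonResolvesRayChartRegular.lean`):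

* `schonResolves_isSMulRegular_algebraMap_of_isLocalization` — the image of a non-zero-divisor in a
  localization is a non-zero-divisor;
* `schonResolves_isRegularLocalRing_of_mem_of_quotient_span` — a Noetherian ring `A` is regular at every
  prime through a non-zero-divisor `x` with `A ⧸ (x)` regular (Matsumura, Thm 19.2, converse step:
  `IsRegularLocalRing.of_quotient_span_singleton` of the tree, plus "localization commutes with
  quotients", `isRegularLocalRing_localization_quotient_span_singleton`);
* `schonResolves_isRegularLocalRing_of_not_mem_of_away` — `A` is regular at every prime avoiding `x`
  if its localization away from `x` is regular (localization of a localization).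

No new definitions. Reference: H. Matsumura, *Commutative Ring Theory*, Thm 19.2 [Matsumura1987].
-/

-- single-problem summit: the doubled namespace component `ResolutionOfSingularities` is forced
set_option linter.dupNamespace false

namespace Summit.ResolutionOfSingularities.ResolutionOfSingularities.Theorems

open Literature.AlgebraicGeometry.Resolution

/-- In a localization, the image of a non-zero-divisor `x` of `A` (in the sense `x • a = 0 → a = 0`,
i.e. `IsSMulRegular A x`) is again `IsSMulRegular`. [folklore] -/
theorem schonResolves_isSMulRegular_algebraMap_of_isLocalization {A : Type} [CommRing A]
    (M : Submonoid A) (T : Type) [CommRing T] [Algebra A T] [IsLocalization M T] {x : A}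
    (hx : IsSMulRegular A x) : IsSMulRegular T (algebraMap A T x) := by
  intro a b hab
  obtain ⟨⟨ra, sa⟩, rfl⟩ := IsLocalization.mk'_surjective M a
  obtain ⟨⟨rb, sb⟩, rfl⟩ := IsLocalization.mk'_surjective M b
  change algebraMap A T x * IsLocalization.mk' T ra sa = algebraMap A T x * IsLocalization.mk' T rb sb
    at hab
  rw [IsLocalization.mul_mk'_eq_mk'_of_mul, IsLocalization.mul_mk'_eq_mk'_of_mul,
    IsLocalization.mk'_eq_iff_eq, IsLocalization.eq_iff_exists M T] at hab
  obtain ⟨c, hc⟩ := hab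
  rw [IsLocalization.mk'_eq_iff_eq, IsLocalization.eq_iff_exists M T]
  refine ⟨c, hx ?_⟩
  change x * (↑c * (↑sb * ra)) = x * (↑c * (↑sa * rb))
  calc x * (↑c * (↑sb * ra)) = ↑c * (↑sb * (x * ra)) := by ring
    _ = ↑c * (↑sa * (x * rb)) := hc
    _ = x * (↑c * (↑sa * rb)) := by ring

/-- **Regularity along a Cartier divisor from regularity of the divisor.** Let `A` be a Noetherian
ring and `x ∈ A` a non-zero-divisor such that every localization of `A ⧸ (x)` at a prime is a
regular local ring. Then `A` is regular at every prime containing `x`: in `A_P` the element `x`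
lies in the maximal ideal, is `A_P`-regular, and `A_P ⧸ (x) ≅ (A ⧸ (x))_{P/(x)}` is regular, so
`A_P` is regular (Matsumura, Thm 19.2, converse step: `IsRegularLocalRing.of_quotient_span_singleton`).
[cite: Matsumura1987, Thm. 19.2] -/
theorem schonResolves_isRegularLocalRing_of_mem_of_quotient_span :
    ∀ (A : Type) [CommRing A] [IsNoetherianRing A] (x : A), IsSMulRegular A x → (∀ (Q : Ideal (A ⧸ Ideal.span {x})) [Q.IsPrime], IsRegularLocalRing (Localization.AtPrime Q)) → ∀ (P : Ideal A) [P.IsPrime], x ∈ P → IsRegularLocalRing (Localization.AtPrime P) := by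
  intro A _ _ x hx h P _ hxP
  have hmem : algebraMap A (Localization.AtPrime P) x ∈
      IsLocalRing.maximalIdeal (Localization.AtPrime P) := by
    rw [← Localization.AtPrime.map_eq_maximalIdeal]
    exact Ideal.mem_map_of_mem _ hxP
  have hreg : IsSMulRegular (Localization.AtPrime P) (algebraMap A (Localization.AtPrime P) x) :=
    schonResolves_isSMulRegular_algebraMap_of_isLocalization P.primeCompl (Localization.AtPrime P) hx
  have hIP : Ideal.span {x} ≤ P := by
    rw [Ideal.span_le, Set.singleton_subset_iff]
    exact hxP
  haveI hPbar : (P.map (Ideal.Quotient.mk (Ideal.span {x}))).IsPrime :=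
    Ideal.map_isPrime_of_surjective Ideal.Quotient.mk_surjective (by rwa [Ideal.mk_ker])
  have hcomap : (P.map (Ideal.Quotient.mk (Ideal.span {x}))).comap (Ideal.Quotient.mk _) = P := by
    rw [Ideal.comap_map_of_surjective _ Ideal.Quotient.mk_surjective, ← RingHom.ker_eq_comap_bot,
      Ideal.mk_ker, sup_eq_left.2 hIP]
  haveI := h (P.map (Ideal.Quotient.mk (Ideal.span {x})))
  have hq := isRegularLocalRing_localization_quotient_span_singleton x
    (P.map (Ideal.Quotient.mk (Ideal.span {x})))
  -- transport from the prime `comap (map P) = P` to `P` through the canonical isomorphism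
  have hsub : ((P.map (Ideal.Quotient.mk (Ideal.span {x}))).comap
      (Ideal.Quotient.mk (Ideal.span {x}))).primeCompl = P.primeCompl := by
    ext y
    change y ∉ _ ↔ y ∉ P
    rw [hcomap]
    exact Iff.rfl
  haveI : IsLocalization.AtPrime (Localization.AtPrime
      ((P.map (Ideal.Quotient.mk (Ideal.span {x}))).comap (Ideal.Quotient.mk (Ideal.span {x})))) P := by
    change IsLocalization P.primeCompl _
    rw [← hsub]
    infer_instance
  let e : Localization.AtPrime
      ((P.map (Ideal.Quotient.mk (Ideal.span {x}))).comap (Ideal.Quotient.mk (Ideal.span {x}))) ≃ₐ[A]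
        Localization.AtPrime P :=
    IsLocalization.algEquiv P.primeCompl _ _
  have he : ∀ a : A, e (algebraMap A _ a) = algebraMap A (Localization.AtPrime P) a :=
    fun a => e.commutes a
  have hmapI : (Ideal.span {algebraMap A (Localization.AtPrime
      ((P.map (Ideal.Quotient.mk (Ideal.span {x}))).comap (Ideal.Quotient.mk (Ideal.span {x})))) x}).map
        e.toRingEquiv.toRingHom =
      Ideal.span {algebraMap A (Localization.AtPrime P) x} := by
    rw [Ideal.map_span, Set.image_singleton]
    change Ideal.span {e _} = _
    rw [he]
  haveI : IsRegularLocalRing (Localization.AtPrime P ⧸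
      Ideal.span {algebraMap A (Localization.AtPrime P) x}) :=
    IsRegularLocalRing.of_ringEquiv
      ((Ideal.quotientEquiv _ _ e.toRingEquiv rfl).trans (Ideal.quotEquivOfEq hmapI))
  exact IsRegularLocalRing.of_quotient_span_singleton hmem hreg

/-- **Regularity on a principal open from regularity of the localization.** If `T` is the
localization of `A` away from `x` and every localization of `T` at a prime is a regular local
ring, then `A` is regular at every prime not containing `x` (`A_P` is a localization of `T` at the
extended prime). [folklore] -/
theorem schonResolves_isRegularLocalRing_of_not_mem_of_away {A : Type} [CommRing A] (x : A)
    (T : Type) [CommRing T] [Algebra A T] [IsLocalization.Away x T]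
    (h : ∀ (q : Ideal T) [q.IsPrime], IsRegularLocalRing (Localization.AtPrime q))
    (P : Ideal A) [hP : P.IsPrime] (hxP : x ∉ P) : IsRegularLocalRing (Localization.AtPrime P) := by
  have hdisj := (Ideal.disjoint_powers_iff_notMem_of_isPrime (I := P) x).2 hxP
  haveI hp : (P.map (algebraMap A T)).IsPrime :=
    IsLocalization.isPrime_of_isPrime_disjoint (Submonoid.powers x) T P hP hdisj
  have hunder : (P.map (algebraMap A T)).comap (algebraMap A T) = P :=
    IsLocalization.under_map_of_isPrime_disjoint (Submonoid.powers x) T hP hdisj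
  haveI hT : IsLocalization.AtPrime (Localization.AtPrime (P.map (algebraMap A T)))
      ((P.map (algebraMap A T)).comap (algebraMap A T)) :=
    IsLocalization.isLocalization_isLocalization_atPrime_isLocalization (Submonoid.powers x)
      (Localization.AtPrime (P.map (algebraMap A T))) (P.map (algebraMap A T))
  have hsub : ((P.map (algebraMap A T)).comap (algebraMap A T)).primeCompl = P.primeCompl := by
    ext y
    change y ∉ _ ↔ y ∉ P
    rw [hunder]
    exact Iff.rfl
  haveI : IsLocalization.AtPrime (Localization.AtPrime (P.map (algebraMap A T))) P := by
    change IsLocalization P.primeCompl _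
    rw [← hsub]
    exact hT
  haveI := h (P.map (algebraMap A T))
  exact IsRegularLocalRing.of_ringEquiv
    (IsLocalization.algEquiv P.primeCompl (Localization.AtPrime (P.map (algebraMap A T)))
      (Localization.AtPrime P)).toRingEquiv

end Summit.ResolutionOfSingularities.ResolutionOfSingularities.Theorems
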